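import Mathlib
import Literature.NumberTheory.LFunctions.Zhang2022.Section6Statements
import Literature.NumberTheory.LFunctions.Zhang2022.Section5VerticalShift
import Literature.NumberTheory.LFunctions.Zhang2022.Section6SegmentSplit
import HarnessLib

/-!
# Zhang (2022), §6: the contour move for (6.2) and "whence (6.2) follows" — DISCHARGED

Topic `Literature/NumberTheory/LFunctions/Zhang2022` (Landau–Siegel audit tree; verdict-neutral).
Y. Zhang, *Discrete mean estimates and the Landau–Siegel zero*, arXiv:2211.02515v1 (2022)
[Zhang2022LandauSiegel] — **an unrefereed manuscript under adjudication**; campaign D-0069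
(typed ≠ discharged). This file DISCHARGES two proof-internal nodes of the proof of Lemma 6.1
(§6 pp. 31–32), typed statement-exact by `Section6Statements` (L2-t1, v2 p412099):

* `Z22:§6.u010`–`u012` = `Section6Statements.Step6u010` (tex L1735–1745): "We move the contour of
  integration in (6.2) to the vertical segments `u = −1, |v| > 𝓛²⁰` and `u = −𝓛⁹, |v| ≤ 𝓛²⁰` with
  the horizontal connecting segments `−𝓛⁹ ≤ u ≤ −1, |v| = 𝓛²⁰`" — Cauchy's theorem on the
  rectangle `[−𝓛⁹,−1] × [−𝓛²⁰,𝓛²⁰]` (Mathlib `Complex.integral_boundary_rect_eq_zero_of_differentiableOn`)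
  for the (6.2)-integrand `Z(s+w,ψ)(Σ_{n≥T³} ψ̄(n)n^{−(1−s−w)})P₄^w ω₁(w)/w`, which is holomorphic on
  `Re w ≤ −1` (`w ≠ 0`, kernel holomorphy `differentiableAt_kern` from seat sz-d08's `Section6SegmentSplit`;
  the tail is an absolutely convergent Dirichlet series in `1−s−w`,
  `Re(1−s−w) ≥ 2 − σ > 1`; `Z(·,ψ)` is holomorphic on the upper half-plane, tree
  `GammaFactor.differentiableAt_Zfac`, and `Im(s+w) ≥ 2πt₀ − 𝓛₁ − 2 − 𝓛²⁰ > 0`);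
* `Z22:Lem6.1.pf` prose "whence (6.2) follows" = `Section6Statements.DedEq62` (tex L1754): the
  contour identity, the outer-segment bound and the two pointwise bounds on `−𝓛⁹ ≤ u ≤ −1` imply
  (6.2), the `ε = exp{−c𝓛¹⁰}` being supplied by `|ω₁(u ± i𝓛²⁰)| = exp{(u² − 𝓛⁴⁰)/(4𝓛³⁰)} ≤
  exp{(𝓛¹⁸ − 𝓛⁴⁰)/(4𝓛³⁰)}` on the horizontals and by `(2T²)^{𝓛⁹}T^{−3𝓛⁹+e} = 2^{𝓛⁹}T^{e−𝓛⁹}`,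
  `T = exp{𝓛^{1.1}}`, on `u = −𝓛⁹`. The deduction is proved with the tail exponent as a PARAMETER
  `e` (`eq62_of_bounds`, hypothesis inlined): the typed node has the printed `3u + 1/2`
  (`dedEq62_holds`), and the trivially provable tail bound has `3u + 3/2` (seat sz-d23's repair of
  `Step6u014`); both compose.

0 new facts (F-06/F-09 handles only through the tree's `GammaFactor`/`GaussWeight` theorems). The
blanket Assumption (A) carried by the typed nodes is passed through, never used. WHAT THIS IS NOT:
any claim about Theorems 1–2 of the source or about Landau–Siegel zeros.

## References

* Y. Zhang, arXiv:2211.02515v1 (2022), §6 pp. 31–32, (6.2); §4 p. 18 (`ω₁`).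
  [cite: Zhang2022LandauSiegel, §6 (6.2) pp.31–32, tex L1729–1754]
-/

noncomputable section

open Complex Real ComplexConjugate MeasureTheory Set intervalIntegral

namespace Literature.NumberTheory.LFunctions.Zhang2022.Section6Statements

open Skeleton

variable {D : ℕ}

/-! ## Holomorphy of the (6.2)-integrand on `Re w ≤ −1` -/

/-- The tail `Σ_{n≥T³} ψ̄(n)n^{−(1−s−w)}` is the Dirichlet series, at `1 − s − w`, of the bounded
sequence `ψ̄·𝟙_{n ≥ T³}`. [cite: Zhang2022LandauSiegel, §6 (6.2) p.31] -/
theorem tailSum_eq_LSeries (x : Chr D) (s w : ℂ) :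
    tailSum x s w =
      LSeries (fun n : ℕ => if bigT D ^ 3 ≤ (n : ℝ) then psiBarFn x n else 0) (1 - s - w) := by
  rw [tailSum, LSeries]
  refine tsum_congr fun n => ?_
  have h0 : (fun n : ℕ => if bigT D ^ 3 ≤ (n : ℝ) then psiBarFn x n else 0) 0 = 0 := by
    have hT : ¬ bigT D ^ 3 ≤ ((0 : ℕ) : ℝ) := by
      rw [Nat.cast_zero, not_le]; exact pow_pos (Real.exp_pos _) 3
    simp only [hT, if_false]
  rw [LSeries.term_def₀ h0]
  split_ifs <;> simp

/-- The tail is holomorphic in `w` wherever `Re(1 − s − w) > 1`. [cite: Zhang2022LandauSiegel, §6 (6.2) p.31] -/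
theorem differentiableAt_tailSum (x : Chr D) (s : ℂ) {w : ℂ} (hw : 1 < (1 - s - w).re) :
    DifferentiableAt ℂ (tailSum x s) w := by
  set a : ℕ → ℂ := fun n => if bigT D ^ 3 ≤ (n : ℝ) then psiBarFn x n else 0 with ha
  have hfun : tailSum x s = fun w => LSeries a (1 - s - w) := by
    funext w; rw [tailSum_eq_LSeries]
  have habs : LSeries.abscissaOfAbsConv a ≤ 1 := by
    refine LSeries.abscissaOfAbsConv_le_of_le_const ⟨1, fun n _ => ?_⟩
    simp only [ha]
    split_ifs
    · rw [psiBarFn, Complex.norm_conj]; exact DirichletCharacter.norm_le_one _ _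
    · simp
  have hlt : LSeries.abscissaOfAbsConv a < ((1 - s - w).re : EReal) :=
    lt_of_le_of_lt habs (by exact_mod_cast hw)
  have hL : DifferentiableAt ℂ (LSeries a) (1 - s - w) := (LSeries_hasDerivAt hlt).differentiableAt
  have hlin : DifferentiableAt ℂ (fun w : ℂ => 1 - s - w) w := by fun_prop
  rw [hfun]
  exact hL.comp w hlin

/-- The (6.2)-integrand is holomorphic at every `w ≠ 0` with `Im(s+w) > 0` and `Re(1−s−w) > 1`.
[cite: Zhang2022LandauSiegel, §6 (6.2) pp.31–32] -/
theorem differentiableAt_integrand62 (hD : 2 ≤ D) (x : Chr D) (s : ℂ) {w : ℂ} (hw : w ≠ 0)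
    (him : 0 < (s + w).im) (hre : 1 < (1 - s - w).re) :
    DifferentiableAt ℂ (integrand62 x s) w := by
  have hZ : DifferentiableAt ℂ (fun w => GammaFactor.Zfac x.ψ (s + w)) w :=
    (GammaFactor.differentiableAt_Zfac x.ψ him).comp w (by fun_prop)
  have h := (hZ.mul (differentiableAt_tailSum x s hre)).mul (differentiableAt_kern hD hw)
  exact h

/-! ## Elementary size facts about the parameters -/

/-- `𝓛 = log D ≥ log 4 > 4/3` for `D ≥ 4` (`𝓛` of (2.1)). [cite: Zhang2022LandauSiegel, §2 (2.1)] -/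
theorem four_thirds_lt_ell (hD : 4 ≤ D) : 4 / 3 < ell D := by
  have hD' : (4 : ℝ) ≤ D := by exact_mod_cast hD
  have h4 : (4 : ℝ) / 3 < Real.log 4 := by
    rw [Real.lt_log_iff_exp_lt (by norm_num)]
    have h3 : Real.exp (1 / 3) < 1.4 := by
      have key : Real.exp (1 / 3) ^ 3 = Real.exp 1 := by
        rw [← Real.exp_nat_mul]; norm_num
      by_contra hc
      push Not at hc
      have : (1.4 : ℝ) ^ 3 ≤ Real.exp (1 / 3) ^ 3 := by gcongr
      rw [key] at this
      linarith [Real.exp_one_lt_d9]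
    have h : Real.exp (4 / 3) = Real.exp 1 * Real.exp (1 / 3) := by
      rw [← Real.exp_add]; norm_num
    rw [h]
    nlinarith [Real.exp_pos (1 / 3), Real.exp_pos 1, Real.exp_one_lt_d9]
  exact h4.trans_le (Real.log_le_log (by norm_num) hD')

/-- `α = π𝓛⁻⁹ < 1/4` for `D ≥ 4` (`α = π/log P`, (2.10)). [cite: Zhang2022LandauSiegel, §2 (2.10)] -/
theorem alpha_lt_quarter' (hD : 4 ≤ D) : alpha D < 1 / 4 := by
  have hlog := four_thirds_lt_ell hD
  rw [ell] at hlog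
  have hℓ : alpha D = π / Real.log D ^ 9 := by rw [alpha, bigP, Real.log_exp, ell]
  rw [hℓ, div_lt_iff₀ (by positivity)]
  have h9 : ((4 : ℝ) / 3) ^ 9 < Real.log D ^ 9 := by gcongr
  have hπ : π < 3.15 := Real.pi_lt_d2
  norm_num at h9
  linarith

/-- In the range of Lemma 6.1, `σ < 1` and `Im s > 𝓛²⁰ + 1` (for `D ≥ 4`): `2πt₀ − 𝓛₁ − 2 > 𝓛²⁰ + 1`
since `t₀ = 𝓛⁵¹⁹`, `𝓛₁ = 𝓛⁴⁰⁵`, `𝓛 > 4/3`. [cite: Zhang2022LandauSiegel, §6 Lemma 6.1 p.30] -/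
theorem inRange61_bounds (hD : 4 ≤ D) {s : ℂ} (hr : InRange61 D s) :
    s.re < 1 ∧ ell D ^ 20 + 1 < s.im := by
  have hα := alpha_lt_quarter' hD
  have hℓ := four_thirds_lt_ell hD
  obtain ⟨hσ, ht⟩ := hr
  refine ⟨by have := (abs_lt.mp hσ).2; linarith, ?_⟩
  have ht' := (abs_lt.mp ht).1
  rw [t0, ell1] at ht'
  have h1 : (1 : ℝ) ≤ ell D := by linarith
  have h405 : ell D ^ 405 ≤ ell D ^ 519 := pow_le_pow_right₀ h1 (by norm_num)
  have h20 : ell D ^ 20 ≤ ell D ^ 519 := pow_le_pow_right₀ h1 (by norm_num)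
  have h0 : (1 : ℝ) ≤ ell D ^ 519 := one_le_pow₀ h1
  have hπ : 3 < π := Real.pi_gt_three
  nlinarith

/-! ## `Z22:§6.u010`–`u012`: the contour move -/

/-- `Z22:§6.u010` `Z22:§6.u011` `Z22:§6.u012` DISCHARGED — the node `Section6Statements.Step6u010`
HOLDS (`D₀ = 4`; (A) unused): for `ψ ∈ Ψ` and `s` in the range of Lemma 6.1, the integral of the
(6.2)-integrand over `[−1−i𝓛²⁰, −1+i𝓛²⁰]` equals the integral over the three-sided path through
`u = −𝓛⁹` — Cauchy's theorem for the rectangle `[−𝓛⁹,−1] × [−𝓛²⁰,𝓛²⁰]` (Mathlib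
`Complex.integral_boundary_rect_eq_zero_of_differentiableOn`), the integrand being holomorphic on a
neighbourhood of it (`differentiableAt_integrand62`). [cite: Zhang2022LandauSiegel, §6 pp.31–32, tex L1735–1745] -/
theorem step6u010_holds : Step6u010 := by
  refine ⟨4, fun D _ χ hD _ _ _ x s hr => ?_⟩
  have hD2 : 2 ≤ D := le_trans (by norm_num) hD
  have hℓ := four_thirds_lt_ell hD
  obtain ⟨hσ1, him⟩ := inRange61_bounds hD hr
  set L : ℝ := ell D ^ 9 with hL
  set V : ℝ := ell D ^ 20 with hV
  have h1 : (1 : ℝ) ≤ ell D := by linarith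
  have hL1 : 1 ≤ L := one_le_pow₀ h1
  have hV0 : 0 ≤ V := by positivity
  set f : ℂ → ℂ := integrand62 x s with hf
  -- holomorphy on the closed rectangle `[−L,−1] × [−V,V]`
  have hdiff : DifferentiableOn ℂ f (Set.uIcc (⟨-L, -V⟩ : ℂ).re (⟨-1, V⟩ : ℂ).re ×ℂ
      Set.uIcc (⟨-L, -V⟩ : ℂ).im (⟨-1, V⟩ : ℂ).im) := by
    intro w hw
    have hw' : w.re ∈ Set.uIcc (-L) (-1) ∧ w.im ∈ Set.uIcc (-V) V := by
      simpa [Complex.mem_reProdIm] using hw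
    obtain ⟨hre, hwi⟩ := hw'
    rw [Set.uIcc_of_le (by linarith), Set.mem_Icc] at hre
    rw [Set.uIcc_of_le (by linarith), Set.mem_Icc] at hwi
    have hw0 : w ≠ 0 := by
      intro h; rw [h] at hre; simp at hre; linarith
    have him' : 0 < (s + w).im := by rw [add_im]; linarith
    have hre' : 1 < (1 - s - w).re := by simp; linarith
    exact (differentiableAt_integrand62 hD2 x s hw0 him' hre').differentiableWithinAt
  have key := Complex.integral_boundary_rect_eq_zero_of_differentiableOn f ⟨-L, -V⟩ ⟨-1, V⟩ hdiff
  simp only [smul_eq_mul] at key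
  have e1 : (∫ y : ℝ in (-V)..V, f (((-1 : ℝ) : ℂ) + y * I)) = ∫ y : ℝ in (-V)..V, f (-1 + y * I) := by
    congr 1; funext y; push_cast; ring_nf
  rw [e1] at key
  rw [intervalIntegral.integral_symm (-L) (-1 : ℝ)]
  linear_combination key

/-! ## `Z22:Lem6.1.pf` "whence (6.2) follows" -/

/-- `(2T²)^{−u}·T^{3u+e} = exp{−u log 2 + (u + e)𝓛^{1.1}}` (`T = exp{𝓛^{1.1}}`, §6 p. 30): the
product of the two printed bounds of §6 p. 32. [cite: Zhang2022LandauSiegel, §6 p.32, tex L1747–1751] -/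
theorem zp4_mul_tail_eq (D : ℕ) (u e : ℝ) :
    (2 * bigT D ^ 2) ^ (-u) * bigT D ^ (3 * u + e) =
      Real.exp (-u * Real.log 2 + (u + e) * ell D ^ (1.1 : ℝ)) := by
  set τ : ℝ := ell D ^ (1.1 : ℝ) with hτ
  have hT : bigT D = Real.exp τ := rfl
  have hT0 : 0 < bigT D := Real.exp_pos _
  have h2T : 0 < 2 * bigT D ^ 2 := by positivity
  rw [Real.rpow_def_of_pos h2T, Real.log_mul (by norm_num) (pow_pos hT0 2).ne', Real.log_pow, hT,
    Real.log_exp, ← Real.exp_mul, ← Real.exp_add]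
  congr 1
  push_cast
  ring

/-- Pointwise size of the (6.2)-integrand at `w = u + iv`: `|Z(s+w,ψ)P₄^w|·|tail|·|ω₁(w)|/|w|` with
`|ω₁(u+iv)| = exp{(u² − v²)/(4𝓛³⁰)}` (tree `GaussWeight.norm_omega1`).
[cite: Zhang2022LandauSiegel, §6 (6.2) p.32] -/
theorem norm_integrand62_le (x : Chr D) (s : ℂ) (u v A B : ℝ) (hA : 0 ≤ A)
    (hZ : ‖GammaFactor.Zfac x.ψ (s + (u + v * I)) * ((P4 D : ℝ) : ℂ) ^ ((u : ℂ) + v * I)‖ ≤ A)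
    (hT : ‖tailSum x s (u + v * I)‖ ≤ B) :
    ‖integrand62 x s (u + v * I)‖ ≤
      A * B * Real.exp ((u ^ 2 - v ^ 2) / (4 * ell D ^ 30)) / ‖(u : ℂ) + v * I‖ := by
  have e : integrand62 x s (u + v * I) =
      (GammaFactor.Zfac x.ψ (s + (u + v * I)) * ((P4 D : ℝ) : ℂ) ^ ((u : ℂ) + v * I)) *
        tailSum x s (u + v * I) * GaussWeight.omega1 (ell D ^ 30) (u + v * I) /
          ((u : ℂ) + v * I) := by
    unfold integrand62 kern; ring
  rw [e, norm_div, norm_mul, norm_mul, GaussWeight.norm_omega1]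
  have hB : 0 ≤ B := le_trans (norm_nonneg _) hT
  gcongr

/-- The (6.2)-integrand under the two pointwise bounds of §6 p. 32 (`Z(s+w,ψ)P₄^w ≤ C₁(2T²)^{−u}`,
tail `≤ C₂T^{3u+e}`), for `u ≤ −1` (so that `|w| ≥ 1`):
`‖integrand‖ ≤ C₁C₂·exp{−u log 2 + (u+e)𝓛^{1.1}}·exp{(u²−v²)/(4𝓛³⁰)}`.
[cite: Zhang2022LandauSiegel, §6 (6.2) p.32] -/
theorem norm_integrand62_le_of_bounds (x : Chr D) (s : ℂ) {u v e C₁ C₂ : ℝ} (hC₁ : 0 ≤ C₁)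
    (hu : u ≤ -1)
    (hZ : ‖GammaFactor.Zfac x.ψ (s + (u + v * I)) * ((P4 D : ℝ) : ℂ) ^ ((u : ℂ) + v * I)‖ ≤
      C₁ * (2 * bigT D ^ 2) ^ (-u))
    (hT : ‖tailSum x s (u + v * I)‖ ≤ C₂ * bigT D ^ (3 * u + e)) :
    ‖integrand62 x s (u + v * I)‖ ≤
      C₁ * C₂ * Real.exp (-u * Real.log 2 + (u + e) * ell D ^ (1.1 : ℝ)) *
        Real.exp ((u ^ 2 - v ^ 2) / (4 * ell D ^ 30)) := by
  have hp1 : 0 ≤ (2 * bigT D ^ 2) ^ (-u) :=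
    Real.rpow_nonneg (by positivity [Real.exp_pos (ell D ^ (1.1 : ℝ))]) _
  have hA : 0 ≤ C₁ * (2 * bigT D ^ 2) ^ (-u) := mul_nonneg hC₁ hp1
  have h0 := norm_integrand62_le x s u v _ _ hA hZ hT
  have hB : 0 ≤ C₂ * bigT D ^ (3 * u + e) := le_trans (norm_nonneg _) hT
  have hw1 : 1 ≤ ‖(u : ℂ) + v * I‖ := by
    have h := Complex.abs_re_le_norm ((u : ℂ) + v * I)
    have hre : ((u : ℂ) + v * I).re = u := by simp
    rw [hre, abs_of_nonpos (by linarith)] at h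
    linarith
  have hnum : 0 ≤ C₁ * (2 * bigT D ^ 2) ^ (-u) * (C₂ * bigT D ^ (3 * u + e)) *
      Real.exp ((u ^ 2 - v ^ 2) / (4 * ell D ^ 30)) :=
    mul_nonneg (mul_nonneg hA hB) (Real.exp_pos _).le
  have hprod : C₁ * (2 * bigT D ^ 2) ^ (-u) * (C₂ * bigT D ^ (3 * u + e)) =
      C₁ * C₂ * Real.exp (-u * Real.log 2 + (u + e) * ell D ^ (1.1 : ℝ)) := by
    rw [← zp4_mul_tail_eq]; ring
  calc ‖integrand62 x s (u + v * I)‖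
      ≤ C₁ * (2 * bigT D ^ 2) ^ (-u) * (C₂ * bigT D ^ (3 * u + e)) *
          Real.exp ((u ^ 2 - v ^ 2) / (4 * ell D ^ 30)) / ‖(u : ℂ) + v * I‖ := h0
    _ ≤ C₁ * (2 * bigT D ^ 2) ^ (-u) * (C₂ * bigT D ^ (3 * u + e)) *
          Real.exp ((u ^ 2 - v ^ 2) / (4 * ell D ^ 30)) := div_le_self hnum hw1
    _ = _ := by rw [hprod]

/-- A real number is at most its exponential's logarithmic bound: `y ≤ exp y`. [folklore] -/
private theorem le_exp_self (y : ℝ) : y ≤ Real.exp y := by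
  linarith [Real.add_one_le_exp y]

/-- `𝓛ⁿ ≤ exp{n𝓛}` for `𝓛 ≥ 0`. [folklore] -/
private theorem pow_le_exp_mul {ℓ : ℝ} (hℓ : 0 ≤ ℓ) (n : ℕ) : ℓ ^ n ≤ Real.exp (n * ℓ) := by
  rw [Real.exp_nat_mul]
  exact pow_le_pow_left₀ hℓ (le_exp_self ℓ) n

/-- The exponent bookkeeping on the horizontal segments: with `L = 𝓛⁹`, `𝓛 ≤ τ = 𝓛^{1.1} ≤ L`,
`𝓛 ≥ 8(22 + E + K)`: `K + L log 2 + Eτ + 1/4 − 𝓛¹⁰/4 + 9𝓛 ≤ −𝓛¹⁰/8`. [folklore] -/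
private theorem exponent_bound_h {ℓ τ L K E : ℝ} (hℓ1 : 1 ≤ ℓ) (hτ9 : τ ≤ L)
    (hL : L = ℓ ^ 9) (hK0 : 0 ≤ K) (hE : 0 ≤ E) (hbig : 8 * (22 + E + K) ≤ ℓ) :
    K + (L * Real.log 2 + E * τ) + (1 / 4 - ℓ ^ 10 / 4) + 9 * ℓ ≤ -(ℓ ^ 10 / 8) := by
  have hL1 : 1 ≤ L := by rw [hL]; exact one_le_pow₀ hℓ1
  have hℓL : ℓ ≤ L := by
    rw [hL]
    calc ℓ = ℓ ^ 1 := (pow_one ℓ).symm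
      _ ≤ ℓ ^ 9 := pow_le_pow_right₀ hℓ1 (by norm_num)
  have hL10 : ℓ ^ 10 = L * ℓ := by rw [hL]; ring
  have hlog2 : Real.log 2 ≤ 1 := by have := Real.log_two_lt_d9; linarith
  have hKL : K ≤ K * L := le_mul_of_one_le_right hK0 hL1
  have p1 : L * Real.log 2 ≤ L := mul_le_of_le_one_right (by linarith) hlog2
  have p2 : E * τ ≤ E * L := mul_le_mul_of_nonneg_left hτ9 hE
  have hmain : L * (K + E + 11) ≤ L * (ℓ / 8) :=
    mul_le_mul_of_nonneg_left (by linarith) (by linarith)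
  rw [hL10]
  nlinarith

/-- The exponent bookkeeping on the far vertical segment `u = −𝓛⁹`:
`K + L log 2 + Eτ − 𝓛¹⁰ + 1/4 + 20𝓛 ≤ −𝓛¹⁰/8`. [folklore] -/
private theorem exponent_bound_v {ℓ τ L K E : ℝ} (hℓ1 : 1 ≤ ℓ) (hτ9 : τ ≤ L)
    (hL : L = ℓ ^ 9) (hK0 : 0 ≤ K) (hE : 0 ≤ E) (hbig : 8 * (22 + E + K) ≤ ℓ) :
    K + (L * Real.log 2 + (E * τ - ℓ ^ 10)) + 1 / 4 + 20 * ℓ ≤ -(ℓ ^ 10 / 8) := by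
  have hL1 : 1 ≤ L := by rw [hL]; exact one_le_pow₀ hℓ1
  have hℓL : ℓ ≤ L := by
    rw [hL]
    calc ℓ = ℓ ^ 1 := (pow_one ℓ).symm
      _ ≤ ℓ ^ 9 := pow_le_pow_right₀ hℓ1 (by norm_num)
  have hL10 : ℓ ^ 10 = L * ℓ := by rw [hL]; ring
  have hlog2 : Real.log 2 ≤ 1 := by have := Real.log_two_lt_d9; linarith
  have hKL : K ≤ K * L := le_mul_of_one_le_right hK0 hL1
  have p1 : L * Real.log 2 ≤ L := mul_le_of_le_one_right (by linarith) hlog2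
  have p2 : E * τ ≤ E * L := mul_le_mul_of_nonneg_left hτ9 hE
  have hmain : L * (K + E + 22) ≤ L * (7 * ℓ / 8) :=
    mul_le_mul_of_nonneg_left (by linarith) (by linarith)
  rw [hL10]
  nlinarith

/-- Splitting a line integral at `±V`: if the two outer pieces have norm `≤ a` and the middle piece
has norm `≤ m` (`a, m ≥ 0`), then `‖∫_ℝ f‖ ≤ a + m + a` (trivially so when `f` is not integrable,
the integral then being `0` by convention). [folklore] -/
private theorem norm_integral_le_of_pieces {f : ℝ → ℂ} {V a m : ℝ}
    (hIio : ‖∫ v in Set.Iio (-V), f v‖ ≤ a) (hIoi : ‖∫ v in Set.Ioi V, f v‖ ≤ a)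
    (hmid : ‖∫ v in (-V)..V, f v‖ ≤ m) (ha : 0 ≤ a) (hm : 0 ≤ m) : ‖∫ v, f v‖ ≤ a + m + a := by
  by_cases hint : Integrable f volume
  · have e1 := intervalIntegral.integral_Iio_add_Ici (hint.integrableOn (s := Set.Iio (-V)))
      (hint.integrableOn (s := Set.Ici (-V)))
    have e2 := intervalIntegral.integral_Ici_sub_Ici' (hint.integrableOn (s := Set.Ici (-V)))
      (hint.integrableOn (s := Set.Ici V))
    have e3 : ∫ v in Set.Ici V, f v = ∫ v in Set.Ioi V, f v := integral_Ici_eq_integral_Ioi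
    have hsplit : ∫ v, f v =
        (∫ v in Set.Iio (-V), f v) + (∫ v in (-V)..V, f v) + ∫ v in Set.Ioi V, f v := by
      linear_combination -1 * e1 + e2 + e3
    rw [hsplit]
    calc ‖(∫ v in Set.Iio (-V), f v) + (∫ v in (-V)..V, f v) + ∫ v in Set.Ioi V, f v‖
        ≤ ‖∫ v in Set.Iio (-V), f v‖ + ‖∫ v in (-V)..V, f v‖ + ‖∫ v in Set.Ioi V, f v‖ :=
          norm_add₃_le
      _ ≤ a + m + a := by gcongr
  · rw [integral_undef hint, norm_zero]
    positivity

set_option maxHeartbeats 400000 in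
/-- **`Z22:Lem6.1.pf` "whence (6.2) follows", with the tail exponent as a parameter.** The contour
identity `Step6u010`, the outer-segment bound `Step6outer`, the bound `Step6u013`
(`Z(s+w,ψ)P₄^w ≪ (2T²)^{−u}`) and ANY tail bound `Σ_{n≥T³} ≪ T^{3u+e}` on `−𝓛⁹ ≤ u ≤ −1, |v| ≤ 𝓛²⁰`
(the printed `e = 1/2`, `Step6u014`; the trivially valid `e = 3/2`) imply (6.2) `Eq62`:
on the horizontals `|ω₁| ≤ exp{(𝓛¹⁸ − 𝓛⁴⁰)/(4𝓛³⁰)}` and `(2T²)^{−u}T^{3u+e} ≤ 2^{𝓛⁹}T^{|e|}`; on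
`u = −𝓛⁹`, `(2T²)^{𝓛⁹}T^{−3𝓛⁹+e} = 2^{𝓛⁹}T^{e−𝓛⁹} ≤ 2^{𝓛⁹}T^{|e|}exp{−𝓛¹⁰}`; both are
`≤ exp{−𝓛¹⁰/8}` once `𝓛 ≥ 8(22 + |e| + C₁C₂)`. Kernel-checked; 0 facts.
[cite: Zhang2022LandauSiegel, §6 (6.2) p.32, tex L1754] -/
theorem eq62_of_bounds {e : ℝ} (h10 : Step6u010) (hout : Step6outer) (h13 : Step6u013)
    (h14 : ∃ C : ℝ, ForAllLarge fun D _ χ => AssumptionA D χ → ∀ x : Chr D, ∀ s : ℂ,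
      InRange61 D s → ∀ u v : ℝ, -(ell D ^ 9) ≤ u → u ≤ -1 → |v| ≤ ell D ^ 20 →
        ‖tailSum x s (u + v * I)‖ ≤ C * bigT D ^ (3 * u + e)) :
    Eq62 := by
  obtain ⟨c₀, hc₀, C₀, hout⟩ := hout
  obtain ⟨C₁, h13⟩ := h13
  obtain ⟨C₂, h14⟩ := h14
  set C₁' : ℝ := max C₁ 0 with hC₁'
  set C₂' : ℝ := max C₂ 0 with hC₂'
  set K : ℝ := C₁' * C₂' with hK
  have hC₁'0 : 0 ≤ C₁' := le_max_right _ _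
  have hC₂'0 : 0 ≤ C₂' := le_max_right _ _
  have hK0 : 0 ≤ K := mul_nonneg hC₁'0 hC₂'0
  refine ⟨min c₀ (1 / 8), lt_min hc₀ (by norm_num), 2 * |C₀| + 4, ?_⟩
  obtain ⟨D₀, hall⟩ := ((h10.and hout).and h13).and h14
  set D₁ : ℕ := ⌈Real.exp (8 * (22 + |e| + K))⌉₊ with hD₁
  refine ⟨max (max D₀ D₁) 4, fun D _ χ hD hq hp hA x s hr => ?_⟩
  have hD₀ : D₀ ≤ D := le_trans (le_trans (le_max_left _ _) (le_max_left _ _)) hD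
  have hD₁D : D₁ ≤ D := le_trans (le_trans (le_max_right _ _) (le_max_left _ _)) hD
  have hD4 : 4 ≤ D := le_trans (le_max_right _ _) hD
  obtain ⟨⟨⟨h10', hout'⟩, h13'⟩, h14'⟩ := hall D χ hD₀ hq hp
  have hid := h10' hA x s hr
  obtain ⟨hIoi, hIio⟩ := hout' hA x s hr
  have hZ := h13' hA x s hr
  have hTl := h14' hA x s hr
  -- the parameters
  set ℓ : ℝ := ell D with hℓdef
  set L : ℝ := ℓ ^ 9 with hLdef
  set V : ℝ := ℓ ^ 20 with hVdef
  set τ : ℝ := ℓ ^ (1.1 : ℝ) with hτdef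
  have hℓ43 : 4 / 3 < ℓ := four_thirds_lt_ell hD4
  have hℓ1 : 1 ≤ ℓ := by linarith
  have hℓ0 : 0 ≤ ℓ := by linarith
  have hℓbig : 8 * (22 + |e| + K) ≤ ℓ := by
    have h1 : Real.exp (8 * (22 + |e| + K)) ≤ D :=
      le_trans (Nat.le_ceil _) (by exact_mod_cast hD₁D)
    have := Real.log_le_log (Real.exp_pos _) h1
    rwa [Real.log_exp] at this
  have hL1 : 1 ≤ L := one_le_pow₀ hℓ1
  have hV1 : 1 ≤ V := one_le_pow₀ hℓ1
  have hτℓ : ℓ ≤ τ := by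
    have := Real.rpow_le_rpow_of_exponent_le hℓ1 (show (1 : ℝ) ≤ 1.1 by norm_num)
    rwa [Real.rpow_one] at this
  have hτ9 : τ ≤ L := by
    have := Real.rpow_le_rpow_of_exponent_le hℓ1 (show (1.1 : ℝ) ≤ (9 : ℕ) by norm_num)
    rwa [Real.rpow_natCast] at this
  have hτ0 : 0 ≤ τ := le_trans hℓ0 hτℓ
  have hℓL : ℓ ≤ L := le_trans hτℓ hτ9
  have hL10 : L * ℓ = ℓ ^ 10 := by rw [hLdef]; ring
  have hlog2 : Real.log 2 ≤ 1 := by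
    have := Real.log_two_lt_d9; linarith
  have hlog2' : 0 ≤ Real.log 2 := Real.log_nonneg (by norm_num)
  have he : e ≤ |e| := le_abs_self e
  -- the Gaussian factors
  have hΛ : 0 < 4 * ell D ^ 30 := by positivity
  have h18 : ℓ ^ 18 ≤ ℓ ^ 30 := pow_le_pow_right₀ hℓ1 (by norm_num)
  have hL2 : L ^ 2 = ℓ ^ 18 := by rw [hLdef]; ring
  have hV2 : V ^ 2 = ℓ ^ 40 := by rw [hVdef]; ring
  have hΛ' : 4 * ell D ^ 30 = 4 * ℓ ^ 30 := by rw [hℓdef]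
  have hgauss_h : (L ^ 2 - V ^ 2) / (4 * ell D ^ 30) ≤ 1 / 4 - ℓ ^ 10 / 4 := by
    rw [div_le_iff₀ hΛ, hΛ', hL2, hV2]
    have e40 : (1 / 4 - ℓ ^ 10 / 4) * (4 * ℓ ^ 30) = ℓ ^ 30 - ℓ ^ 40 := by ring
    rw [e40]
    linarith
  have hgauss_v : L ^ 2 / (4 * ell D ^ 30) ≤ 1 / 4 := by
    rw [div_le_iff₀ hΛ, hΛ', hL2]
    linarith
  -- pointwise bounds on the three inner segments
  have hptH : ∀ u : ℝ, -L ≤ u → u ≤ -1 → ∀ v : ℝ, |v| = V →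
      ‖integrand62 x s (u + v * I)‖ ≤
        K * Real.exp (L * Real.log 2 + |e| * τ) * Real.exp (1 / 4 - ℓ ^ 10 / 4) := by
    intro u hu1 hu2 v hv
    have hvV : |v| ≤ V := hv.le
    have hp1 : 0 ≤ (2 * bigT D ^ 2) ^ (-u) := Real.rpow_nonneg (by positivity) _
    have hp2 : 0 ≤ bigT D ^ (3 * u + e) := Real.rpow_nonneg (Real.exp_pos _).le _
    have hZ'' : ‖GammaFactor.Zfac x.ψ (s + (u + v * I)) * ((P4 D : ℝ) : ℂ) ^ ((u : ℂ) + v * I)‖ ≤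
        C₁' * (2 * bigT D ^ 2) ^ (-u) :=
      le_trans (hZ u v hu1 hu2 hvV) (mul_le_mul_of_nonneg_right (le_max_left _ _) hp1)
    have hT'' : ‖tailSum x s (u + v * I)‖ ≤ C₂' * bigT D ^ (3 * u + e) :=
      le_trans (hTl u v hu1 hu2 hvV) (mul_le_mul_of_nonneg_right (le_max_left _ _) hp2)
    have h0 := norm_integrand62_le_of_bounds x s hC₁'0 hu2 hZ'' hT''
    have hexp1 : Real.exp (-u * Real.log 2 + (u + e) * ell D ^ (1.1 : ℝ)) ≤
        Real.exp (L * Real.log 2 + |e| * τ) := by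
      rw [Real.exp_le_exp, ← hℓdef, ← hτdef]
      have p1 : -u * Real.log 2 ≤ L * Real.log 2 :=
        mul_le_mul_of_nonneg_right (by linarith) hlog2'
      have p2 : (u + e) * τ ≤ |e| * τ := mul_le_mul_of_nonneg_right (by linarith) hτ0
      linarith
    have hexp2 : Real.exp ((u ^ 2 - v ^ 2) / (4 * ell D ^ 30)) ≤ Real.exp (1 / 4 - ℓ ^ 10 / 4) := by
      rw [Real.exp_le_exp]
      refine le_trans ?_ hgauss_h
      apply div_le_div_of_nonneg_right _ hΛ.le
      have hv2 : v ^ 2 = V ^ 2 := by rw [← sq_abs, hv]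
      have hu2 : u ^ 2 ≤ L ^ 2 := sq_le_sq' hu1 (by linarith)
      linarith
    refine le_trans h0 ?_
    rw [← hK]
    gcongr
  have hptV : ∀ v : ℝ, |v| ≤ V →
      ‖integrand62 x s ((-L : ℝ) + v * I)‖ ≤
        K * Real.exp (L * Real.log 2 + (|e| * τ - ℓ ^ 10)) * Real.exp (1 / 4) := by
    intro v hv
    have hvV : |v| ≤ V := hv
    have hu1 : -L ≤ -L := le_refl _
    have hu2 : -L ≤ -1 := by linarith
    have hp1 : 0 ≤ (2 * bigT D ^ 2) ^ (-(-L)) := Real.rpow_nonneg (by positivity) _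
    have hp2 : 0 ≤ bigT D ^ (3 * (-L) + e) := Real.rpow_nonneg (Real.exp_pos _).le _
    have hZ'' : ‖GammaFactor.Zfac x.ψ (s + ((-L : ℝ) + v * I)) *
        ((P4 D : ℝ) : ℂ) ^ (((-L : ℝ) : ℂ) + v * I)‖ ≤ C₁' * (2 * bigT D ^ 2) ^ (-(-L)) :=
      le_trans (hZ (-L) v hu1 hu2 hvV) (mul_le_mul_of_nonneg_right (le_max_left _ _) hp1)
    have hT'' : ‖tailSum x s ((-L : ℝ) + v * I)‖ ≤ C₂' * bigT D ^ (3 * (-L) + e) :=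
      le_trans (hTl (-L) v hu1 hu2 hvV) (mul_le_mul_of_nonneg_right (le_max_left _ _) hp2)
    have h0 := norm_integrand62_le_of_bounds x s hC₁'0 hu2 hZ'' hT''
    have hexp1 : Real.exp (-(-L) * Real.log 2 + ((-L) + e) * ell D ^ (1.1 : ℝ)) ≤
        Real.exp (L * Real.log 2 + (|e| * τ - ℓ ^ 10)) := by
      rw [Real.exp_le_exp, ← hℓdef, ← hτdef]
      have p1 : L * ℓ ≤ L * τ := mul_le_mul_of_nonneg_left hτℓ (by linarith)
      have p2 : e * τ ≤ |e| * τ := mul_le_mul_of_nonneg_right he hτ0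
      have e0 : -(-L) * Real.log 2 + ((-L) + e) * τ = L * Real.log 2 + (e * τ - L * τ) := by ring
      rw [e0]
      linarith
    have hexp2 : Real.exp (((-L) ^ 2 - v ^ 2) / (4 * ell D ^ 30)) ≤ Real.exp (1 / 4) := by
      rw [Real.exp_le_exp]
      refine le_trans ?_ hgauss_v
      apply div_le_div_of_nonneg_right _ hΛ.le
      nlinarith [sq_nonneg v]
    refine le_trans h0 ?_
    rw [← hK]
    gcongr
  -- the three inner segment integrals
  set Mh : ℝ := K * Real.exp (L * Real.log 2 + |e| * τ) * Real.exp (1 / 4 - ℓ ^ 10 / 4) with hMh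
  set Mv : ℝ := K * Real.exp (L * Real.log 2 + (|e| * τ - ℓ ^ 10)) * Real.exp (1 / 4) with hMv
  have hMh0 : 0 ≤ Mh := by positivity
  have hMv0 : 0 ≤ Mv := by positivity
  have hV0 : 0 ≤ V := by linarith
  have hH1 : ‖∫ u in (-1 : ℝ)..(-L), integrand62 x s (u + ((-V : ℝ) : ℂ) * I)‖ ≤
      Mh * (L - 1) := by
    have h := intervalIntegral.norm_integral_le_of_norm_le_const (a := (-1 : ℝ)) (b := -L)
      (f := fun u : ℝ => integrand62 x s (u + ((-V : ℝ) : ℂ) * I)) (C := Mh) ?_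
    · have habs : |-L - (-1 : ℝ)| = L - 1 := by
        rw [abs_of_nonpos (by linarith)]; ring
      rwa [habs] at h
    · intro u hu
      rw [Set.uIoc_of_ge (by linarith), Set.mem_Ioc] at hu
      exact hptH u hu.1.le hu.2 _ (by rw [abs_neg, abs_of_nonneg hV0])
  have hH2 : ‖∫ u in (-L)..(-1 : ℝ), integrand62 x s (u + (V : ℂ) * I)‖ ≤
      Mh * (L - 1) := by
    have h := intervalIntegral.norm_integral_le_of_norm_le_const (a := -L) (b := (-1 : ℝ))
      (f := fun u : ℝ => integrand62 x s (u + (V : ℂ) * I)) (C := Mh) ?_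
    · have habs : |(-1 : ℝ) - -L| = L - 1 := by
        rw [abs_of_nonneg (by linarith)]; ring
      rwa [habs] at h
    · intro u hu
      rw [Set.uIoc_of_le (by linarith), Set.mem_Ioc] at hu
      exact hptH u hu.1.le hu.2 _ (abs_of_nonneg hV0)
  have hVert : ‖∫ v in (-V)..V, integrand62 x s (((-L : ℝ) : ℂ) + v * I)‖ ≤ Mv * (2 * V) := by
    have h := intervalIntegral.norm_integral_le_of_norm_le_const (a := -V) (b := V)
      (f := fun v : ℝ => integrand62 x s (((-L : ℝ) : ℂ) + v * I)) (C := Mv) ?_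
    · have habs : |V - -V| = 2 * V := by
        rw [abs_of_nonneg (by linarith)]; ring
      rwa [habs] at h
    · intro v hv
      rw [Set.uIoc_of_le (by linarith), Set.mem_Ioc] at hv
      exact hptV v (abs_le.mpr ⟨hv.1.le, hv.2⟩)
  -- the middle segment via the contour identity
  have hmid : ‖∫ v in (-V)..V, integrand62 x s (-1 + v * I)‖ ≤
      2 * (Mh * (L - 1)) + Mv * (2 * V) := by
    have e1 : ‖∫ v in (-V)..V, integrand62 x s (-1 + v * I)‖ =
        ‖I * ∫ v in (-V)..V, integrand62 x s (-1 + v * I)‖ := by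
      rw [norm_mul, Complex.norm_I, one_mul]
    rw [e1, hid]
    calc _ ≤ ‖(∫ u in (-1 : ℝ)..(-L), integrand62 x s (u + ((-V : ℝ) : ℂ) * I)) +
            I * (∫ v in (-V)..V, integrand62 x s (((-L : ℝ) : ℂ) + v * I))‖ +
          ‖∫ u in (-L)..(-1 : ℝ), integrand62 x s (u + (V : ℂ) * I)‖ :=
          norm_add_le _ _
      _ ≤ (‖∫ u in (-1 : ℝ)..(-L), integrand62 x s (u + ((-V : ℝ) : ℂ) * I)‖ +
            ‖I * (∫ v in (-V)..V, integrand62 x s (((-L : ℝ) : ℂ) + v * I))‖) +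
          ‖∫ u in (-L)..(-1 : ℝ), integrand62 x s (u + (V : ℂ) * I)‖ := by
          gcongr; exact norm_add_le _ _
      _ ≤ (Mh * (L - 1) + Mv * (2 * V)) + Mh * (L - 1) := by
          rw [norm_mul, Complex.norm_I, one_mul]
          gcongr
      _ = 2 * (Mh * (L - 1)) + Mv * (2 * V) := by ring
  -- the two ε-estimates
  have hεh : Mh * L ≤ Real.exp (-(ℓ ^ 10 / 8)) := by
    have h1 : Mh * L ≤ Real.exp K * Real.exp (L * Real.log 2 + |e| * τ) *
        Real.exp (1 / 4 - ℓ ^ 10 / 4) * Real.exp (9 * ℓ) := by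
      rw [hMh]
      have hLexp : L ≤ Real.exp (9 * ℓ) := by
        have := pow_le_exp_mul hℓ0 9; rw [← hLdef] at this; exact_mod_cast this
      gcongr
      exact le_exp_self K
    refine le_trans h1 ?_
    rw [← Real.exp_add, ← Real.exp_add, ← Real.exp_add, Real.exp_le_exp]
    exact exponent_bound_h hℓ1 hτ9 hLdef hK0 (abs_nonneg e) hℓbig
  have hεv : Mv * V ≤ Real.exp (-(ℓ ^ 10 / 8)) := by
    have h1 : Mv * V ≤ Real.exp K * Real.exp (L * Real.log 2 + (|e| * τ - ℓ ^ 10)) *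
        Real.exp (1 / 4) * Real.exp (20 * ℓ) := by
      rw [hMv]
      have hVexp : V ≤ Real.exp (20 * ℓ) := by
        have := pow_le_exp_mul hℓ0 20; rw [← hVdef] at this; exact_mod_cast this
      gcongr
      exact le_exp_self K
    refine le_trans h1 ?_
    rw [← Real.exp_add, ← Real.exp_add, ← Real.exp_add, Real.exp_le_exp]
    exact exponent_bound_v hℓ1 hτ9 hLdef hK0 (abs_nonneg e) hℓbig
  -- `ε`-monotonicity (everything in the `ℓ`-form of the goal)
  have h10pos : 0 ≤ ℓ ^ 10 := by positivity
  have hε0 : Real.exp (-c₀ * ℓ ^ 10) ≤ Real.exp (-(min c₀ (1 / 8)) * ℓ ^ 10) := by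
    rw [Real.exp_le_exp]
    exact mul_le_mul_of_nonneg_right (neg_le_neg (min_le_left c₀ (1 / 8))) h10pos
  have hε8 : Real.exp (-(ℓ ^ 10 / 8)) ≤ Real.exp (-(min c₀ (1 / 8)) * ℓ ^ 10) := by
    rw [Real.exp_le_exp]
    have h := mul_le_mul_of_nonneg_right (neg_le_neg (min_le_right c₀ (1 / 8))) h10pos
    have e0 : -(ℓ ^ 10 / 8) = -(1 / 8 : ℝ) * ℓ ^ 10 := by ring
    rw [e0]
    exact h
  have hexp0 := (Real.exp_pos (-c₀ * ℓ ^ 10)).le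
  have hC₀ := (mul_le_mul_of_nonneg_right (le_abs_self C₀) hexp0).trans
    (mul_le_mul_of_nonneg_left hε0 (abs_nonneg C₀))
  -- assemble
  have hfin := norm_integral_le_of_pieces hIio hIoi hmid (le_trans (norm_nonneg _) hIoi)
    (le_trans (norm_nonneg _) hmid)
  have hL' : Mh * (L - 1) ≤ Mh * L := mul_le_mul_of_nonneg_left (sub_le_self L zero_le_one) hMh0
  have h1 := le_trans hεh hε8
  have h2 := le_trans hεv hε8
  linarith only [hfin, hC₀, h1, h2, hL']

/-- `Z22:Lem6.1.pf` ("whence (6.2) follows") DISCHARGED — the proof node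
`Section6Statements.DedEq62` HOLDS: `Step6u010 → Step6outer → Step6u013 → Step6u014 → Eq62`
(the printed tail exponent `3u + 1/2`; `eq62_of_bounds` with `e = 1/2`).
[cite: Zhang2022LandauSiegel, §6 (6.2) p.32, tex L1754] -/
theorem dedEq62_holds : DedEq62 := fun h10 hout h13 h14 =>
  eq62_of_bounds (e := 1 / 2) h10 hout h13 h14

end Literature.NumberTheory.LFunctions.Zhang2022.Section6Statements
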